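import Summits.ABC.ABC.Theses.RibetTakahashiSplit
import Summits.ABC.ABC.Theorems.RibetTakahashiSplitWeightedSzpiroBoundAbc
import Summits.ABC.ABC.Theorems.RibetTakahashiSplitValuationProductOfCurvesModels
import Literature.NumberTheory.EllipticCurves.SzpiroFreyCurveProofs
import Literature.NumberTheory.DiophantineGeometry.AbcImpliesHall
import Summits.ABC.ABC.Cruxes.ThinWeightedSzpiro.SketchIdeator4

/-!
# Crux stmt-ABC-17927 `ThinWeightedSzpiro` (r3″) — the FREY RE-CUT still contains Hall's conjecture

Crux-strategist calibration (seat `planner-cstrat-stmt-ABC-17927-p1-0`, 2026-08-17), kernel-checked.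

Seven seats (leads 0/c1/a1, triage r1 ×2, r2 ×2, ideators 4–6) recorded that r3″ AS FILED contains
sharp Hall on the squarefree-discriminant slice (`hallSquarefree_of_thinWeightedSzpiro`, p153315) and
recommended, as the planner's escape, the RE-CUT of r3″ to the Frey–Hellegouarch class ("Frey curves never
meet the squarefree slice, so the obstruction disappears").  This file shows the re-cut does NOT escape:

* `ThinWeightedSzpiroFrey` — r3″ with the Frey-isomorphism hypothesis of
  `ManyPrimeValuationProductFrey` added verbatim (= `FreyRecut.FreyThinWeightedSzpiro` of SketchIdeator4 §2,
  `Round2Ideator6.ThinWeightedSzpiroFrey`); `thinFrey_of_thin : ThinWeightedSzpiro → ThinWeightedSzpiroFrey`.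
* `hallTripleAbc_of_thinFrey` — the re-cut crux implies abc (exponent `1+ε`) for the HALL TRIPLES
  `y² + (x³ − y²) = x³` with `x` squarefree, `4 ∣ y`, `gcd(x,y) = 1`, `y² < x³`.
* `hallOnClass_of_thinFrey` — hence Hall's conjecture in the tree's form
  (`Literature.NumberTheory.DiophantineGeometry.HallConjecture`, abc.S17: `C_δ x^{1/2−δ} ≤ |x³ − y²|`)
  on that class: an infinite, Hall-generic two-parameter family (no conductor, no weight, no thinness left).

Mechanism.  The global minimal Frey model `W₀ = freyIntModel₂` of the triple `(y², x³−y², x³)` is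
semistable with `N ∣ rad`, every odd prime of `xy(x³−y²)` multiplicative, `x⁶ ≤ 2|c₄(W₀)|` and
`|Δ(W₀)| ≤ (y²(x³−y²)x³)² ≤ x¹⁸ ≤ N¹⁸` (`x ∣ N` as `x` is odd and squarefree).  So by the absorption lemma
`T ≤ K_η |Δ_min|^η ≤ K_η N^{18η}`: the curve is θ-THIN FOR EVERY θ > 0 with a constant depending on θ only —
the class condition of r3″ is inert on this family exactly as it is on the squarefree slice — and r3″ at
`(ε₁, K_{θ/18})` gives `x¹⁸ ≤ 8|c₄|³ ≤ 8C(N·T)^{6+ε₁}`, `T ≤ K H^{η}` absorbed as in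
`WeightedSzpiroBound.abcLe_of`, `N ≤ rad ≤ x·y·(x³−y²)`, i.e. abc on the Hall triple, i.e. Hall
(bookkeeping of `Literature…AbcImpliesHall.hall_of_abc_exponent`, B–G Thm 12.5.12 (a) ⟹ (b)).

Consequence for the planner: the Frey class is the CUSP (`j ≥ 1728`), which is where Hall's phenomenon
lives; re-cutting removes only the squarefree-Δ presentation `(c₄, c₆, Δ) ↔ (x, y, k)` of Hall, not the
Frey presentation `(k, y², x³)`.  Every presentation of r3″ is Hall-complete (see STRATEGY-CENSUS.md).
Sources: [BombieriGubler2006, 12.5.1–12.5.3, Thm 12.5.12], [SilvermanAEC2009, §IX.7 Conj. 7.4, Thm 7.2].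
-/

noncomputable section

set_option linter.dupNamespace false

namespace Summit.ABC.ABC.Cruxes.ThinWeightedSzpiro.FreyHallKernel

open IsDedekindDomain WeierstrassCurve UniqueFactorizationMonoid
open Literature.NumberTheory Literature.NumberTheory.EllipticCurves
open Literature.NumberTheory.DiophantineGeometry
open Summit.ABC.ABC.Theses.RibetTakahashiSplit Summit.ABC.ABC.Theorems

/-! ## The Frey re-cut of the crux -/

/-- **r3″ restricted to the Frey–Hellegouarch class**: `ThinWeightedSzpiro` with the Frey-isomorphism
hypothesis of `ManyPrimeValuationProductFrey` (`W₀ ⊗ ℚ ≅_ℚ freyCurve (d a) (d b)`, `a, b` coprime,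
`ab(a+b) ≠ 0`, `d ∣ 2`) added verbatim — the restatement recommended by leads c1/a1, triage r1/r2 and
ideators 4–6 (typed there as `FreyRecut.FreyThinWeightedSzpiro` / `Round2Ideator6.ThinWeightedSzpiroFrey`). -/
def ThinWeightedSzpiroFrey : Prop :=
  ∃ θ : ℝ, 0 < θ ∧ ∀ ε : ℝ, 0 < ε → ∀ K : ℝ, ∃ C : ℝ, ∀ W₀ : WeierstrassCurve ℤ,
    (W₀.baseChange ℚ).IsElliptic →
    (∀ v : HeightOneSpectrum ℤ, (W₀.baseChange ℚ).IsMinimalAt v) →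
    (∀ p : ℕ, p.Prime → p ≠ 2 → ¬ p ^ 2 ∣ (W₀.baseChange ℚ).conductorNorm ℤ) →
    (∃ (a b d : ℤ) (C' : VariableChange ℚ), IsCoprime a b ∧ a * b * (a + b) ≠ 0 ∧ d ∣ 2 ∧
        C' • (W₀.baseChange ℚ) = freyCurve (d * a) (d * b)) →
    ((∏ p ∈ ((W₀.baseChange ℚ).conductorNorm ℤ).primeFactors with
          ¬ p ^ 2 ∣ (W₀.baseChange ℚ).conductorNorm ℤ,
        ((W₀.baseChange ℚ).minimalDiscriminantNorm ℤ).factorization p : ℕ) : ℝ) ≤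
      K * (((W₀.baseChange ℚ).conductorNorm ℤ : ℕ) : ℝ) ^ θ →
    ((max |W₀.Δ| (|W₀.c₄| ^ 3) : ℤ) : ℝ) ≤
      C * ((((W₀.baseChange ℚ).conductorNorm ℤ : ℕ) : ℝ) *
        ((∏ p ∈ ((W₀.baseChange ℚ).conductorNorm ℤ).primeFactors with
            ¬ p ^ 2 ∣ (W₀.baseChange ℚ).conductorNorm ℤ,
          ((W₀.baseChange ℚ).minimalDiscriminantNorm ℤ).factorization p : ℕ) : ℝ)) ^ (6 + ε)

/-- It is, verbatim, the re-cut typed by ideator 4 (`FreyRecut.FreyThinWeightedSzpiro`, SketchIdeator4 §2). -/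
example : ThinWeightedSzpiroFrey ↔ FreyRecut.FreyThinWeightedSzpiro := Iff.rfl

/-- The crux implies its Frey re-cut (drop the extra hypothesis). [folklore] -/
theorem thinFrey_of_thin (h : ThinWeightedSzpiro) : ThinWeightedSzpiroFrey := by
  obtain ⟨θ, hθ, hT⟩ := h
  refine ⟨θ, hθ, fun ε hε K ↦ ?_⟩
  obtain ⟨C, hC⟩ := hT ε hε K
  exact ⟨C, fun W₀ hE hmin hss _ hthin ↦ hC W₀ hE hmin hss hthin⟩

/-! ## Serre's arrangement with the discriminant exported -/

/-- **Semistable global minimal Frey model of an abc triple with `16 ∣ abc`, with `|Δ|` exported.**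
Verbatim `ThinFreyTransfer.exists_semistable_minimal_frey_model` (B–G Ex. 12.5.10, model (12.18)
`freyIntModel₂ A B` of Serre's arrangement `A ≡ −1 (4)`, `16 ∣ B`) plus the two facts this file needs:
every odd prime of `abc` divides `N`, and `|Δ(W₀)| = (abc/16)² ≤ (abc)²`.
[cite: BombieriGubler2006, Ex. 12.5.10] -/
theorem exists_frey_model (a b c : ℕ) (h : IsABCTriple a b c) (h16 : 16 ∣ a * b * c) :
    ∃ W₀ : WeierstrassCurve ℤ, (W₀.baseChange ℚ).IsElliptic ∧
      (∀ v : HeightOneSpectrum ℤ, (W₀.baseChange ℚ).IsMinimalAt v) ∧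
      (∀ p : ℕ, p.Prime → ¬ p ^ 2 ∣ (W₀.baseChange ℚ).conductorNorm ℤ) ∧
      (∃ (a' b' d : ℤ) (C' : VariableChange ℚ), IsCoprime a' b' ∧ a' * b' * (a' + b') ≠ 0 ∧
        d ∣ 2 ∧ C' • (W₀.baseChange ℚ) = freyCurve (d * a') (d * b')) ∧
      (W₀.baseChange ℚ).conductorNorm ℤ ∣ rad a b c ∧
      (∀ p ∈ (a * b * c).primeFactors, p ≠ 2 → p ∣ (W₀.baseChange ℚ).conductorNorm ℤ) ∧
      (c : ℤ) ^ 2 ≤ 2 * |W₀.c₄| ∧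
      W₀.Δ.natAbs ≤ (a * b * c) ^ 2 := by
  have h' := h
  obtain ⟨ha, hb, habc, -⟩ := h'
  have hc : 0 < c := by omega
  have habc0 : a * b * c ≠ 0 := by positivity
  obtain ⟨A, B, hAB, hA, hB, hprod, hquad⟩ := exists_arrangement h h16
  have h0 : A * B * (A + B) ≠ 0 := by
    rw [← Int.natAbs_ne_zero, hprod]; exact habc0
  have h4 : 4 ∣ B - A - 1 := by
    have : B - A - 1 = B - (A + 1) := by ring
    rw [this]; exact dvd_sub (dvd_trans (by norm_num) hB) hA
  have h16' : 16 ∣ A * B := dvd_mul_of_dvd_right hB _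
  obtain ⟨hE, hss, hdvd, hN, -⟩ := ValuationProductOfCurves.freyIntModel₂_package hAB h0 hA hB
  rw [hprod] at hdvd hN
  haveI := hE
  refine ⟨freyIntModel₂ A B, hE, isMinimalAt_freyIntModel₂ hAB hA hB, hss, ?_, ?_, hdvd, ?_, ?_⟩
  · refine ⟨A, B, 1, (⟨Units.mk0 (2 : ℚ) two_ne_zero, 0, 1, 0⟩ : VariableChange ℚ)⁻¹, hAB, h0,
      one_dvd _, ?_⟩
    rw [one_mul, one_mul, ← smul_freyCurve_eq_baseChange_freyIntModel₂ h4 h16', inv_smul_smul]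
  · rwa [rad_def]
  · rw [freyIntModel₂_c₄ h4 h16']
    have hq : (0 : ℤ) ≤ A ^ 2 + A * B + B ^ 2 := by
      nlinarith [sq_nonneg (A + B), sq_nonneg A, sq_nonneg B]
    rw [abs_of_nonneg hq, hquad]
    nlinarith [sq_nonneg (a : ℤ), sq_nonneg (b : ℤ)]
  · -- `Δ = (AB/16)² (A+B)² = (A B' (A+B))²` with `B = 16 B'`, and `16 |A B' (A+B)| = abc`
    obtain ⟨B', hB'⟩ := hB
    have he : A * B / 16 = A * B' := by
      rw [hB', show A * (16 * B') = 16 * (A * B') by ring]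
      exact Int.mul_ediv_cancel_left _ (by norm_num)
    have hΔ : (freyIntModel₂ A B).Δ = (A * B' * (A + B)) ^ 2 := by
      rw [freyIntModel₂_Δ h4 h16', he]; ring
    have hm : A * B * (A + B) = 16 * (A * B' * (A + B)) := by rw [hB']; ring
    have h16abs : 16 * (A * B' * (A + B)).natAbs = a * b * c := by
      rw [← hprod, hm, Int.natAbs_mul (16 : ℤ) (A * B' * (A + B))]
      rfl
    have hle : (A * B' * (A + B)).natAbs ≤ a * b * c := by omega
    rw [hΔ, Int.natAbs_pow]
    exact Nat.pow_le_pow_left hle 2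

/-! ## The Frey re-cut implies abc on Hall triples -/

/-- **abc on Hall triples from the Frey re-cut.**  `ThinWeightedSzpiroFrey` implies, for every `ε > 0`,
`x³ ≤ C_ε · rad(y² (x³ − y²) x³)^{1+ε}` for all positive `x, y` with `y² < x³`, `4 ∣ y`, `gcd(x, y) = 1`,
`x` squarefree.  Thinness of the Frey model of `(y², x³−y², x³)` is certified for EVERY class exponent
`θ` by the absorption lemma (`T ≤ K_{θ/18} |Δ_min|^{θ/18}`, `|Δ_min| ≤ x¹⁸ ≤ N¹⁸`), so the class
condition is inert; the rest is the bookkeeping of `WeightedSzpiroBound.abcLe_of`.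
[cite: BombieriGubler2006, Thm. 12.5.12] -/
theorem hallTripleAbc_of_thinFrey (hT : ThinWeightedSzpiroFrey) :
    ∀ ε : ℝ, 0 < ε → ∃ C : ℝ, ∀ X Y : ℕ, 0 < X → 0 < Y → Y ^ 2 < X ^ 3 → 4 ∣ Y →
      Nat.Coprime X Y → Squarefree X →
      (X : ℝ) ^ 3 ≤ C * ((rad (Y ^ 2) (X ^ 3 - Y ^ 2) (X ^ 3) : ℕ) : ℝ) ^ (1 + ε) := by
  obtain ⟨θ, hθ, hθT⟩ := hT
  intro ε hε
  -- parameters depending on `ε` (and `θ`) only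
  set x : ℝ := min ε 1 with hxdef
  have hx : 0 < x := lt_min hε one_pos
  have hx1 : x ≤ 1 := min_le_right _ _
  have hxε : x ≤ ε := min_le_left _ _
  set η : ℝ := x / 20 with hηdef
  have hη : 0 < η := by positivity
  set θ' : ℝ := η * (6 + x) with hθ'def
  have hθ'1 : θ' < 1 := by rw [hθ'def, hηdef]; nlinarith
  have h1θ : 0 < 1 - θ' := sub_pos.mpr hθ'1
  set η₀ : ℝ := θ / 18 with hη₀def
  have hη₀ : 0 < η₀ := by positivity
  obtain ⟨K₀, hK₀, hK₀abs⟩ := WeightedSzpiroBound.prod_factorization_le_rpow hη₀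
  obtain ⟨C₁, hC₁⟩ := hθT x hx K₀
  obtain ⟨K, hK, hKabs⟩ := WeightedSzpiroBound.prod_factorization_le_rpow hη
  set C : ℝ := max C₁ 1 with hCdef
  have hC0 : 0 < C := one_pos.trans_le (le_max_right _ _)
  set K₁ : ℝ := (C * K ^ (6 + x)) ^ (1 / (1 - θ')) with hK₁def
  have hK₁ : 0 ≤ K₁ := by positivity
  set e : ℝ := (6 + x) / (1 - θ') with hedef
  have he0 : 0 ≤ e := by positivity
  have he6 : e ≤ 6 * (1 + ε) := by
    have h := WeightedSzpiroBound.exponent_le hx hx1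
    have h' : e ≤ 6 * (1 + x) := by rw [hedef, hθ'def, hηdef]; simpa [mul_comm] using h
    nlinarith
  set M : ℝ := 8 * K₁ * ((2 : ℝ) ^ 10) ^ e with hMdef
  have hM : 0 ≤ M := by positivity
  refine ⟨M ^ (1 / 6 : ℝ), fun X Y hX hY hlt h4 hcop hsq ↦ ?_⟩
  -- the abc triple `Y² + (X³ − Y²) = X³`
  set a : ℕ := Y ^ 2 with hadef
  set b : ℕ := X ^ 3 - Y ^ 2 with hbdef
  set c : ℕ := X ^ 3 with hcdef
  have ha0 : 0 < a := pow_pos hY 2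
  have hb0 : 0 < b := Nat.sub_pos_of_lt hlt
  have hc0 : 0 < c := pow_pos hX 3
  have habc : a + b = c := Nat.add_sub_cancel' hlt.le
  have hcopXY : Nat.Coprime (Y ^ 2) (X ^ 3) := Nat.Coprime.pow 2 3 hcop.symm
  have hcopab : Nat.Coprime a b := (Nat.coprime_sub_self_right hlt.le).mpr hcopXY
  have h : IsABCTriple a b c := ⟨ha0, hb0, habc, hcopab⟩
  have habc0 : a * b * c ≠ 0 := by positivity
  have h16Y : 16 ∣ a := by
    obtain ⟨Y', rfl⟩ := h4
    exact ⟨Y' ^ 2, by rw [hadef]; ring⟩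
  have h16 : 16 ∣ a * b * c := (h16Y.mul_right b).mul_right c
  obtain ⟨W₀, hE, hmin, hss, hfrey, hNdvd, hodd, hc₄, hΔle⟩ := exists_frey_model a b c h h16
  haveI := hE
  have hss' : ∀ p : ℕ, p.Prime → p ≠ 2 → ¬ p ^ 2 ∣ (W₀.baseChange ℚ).conductorNorm ℤ :=
    fun p hp _ ↦ hss p hp
  set R : ℝ := ((rad a b c : ℕ) : ℝ) with hRdef
  have hRpos : 0 < rad a b c := by rw [rad_def]; exact Nat.radical_pos _
  have hR : (1 : ℝ) ≤ R := by rw [hRdef]; exact_mod_cast hRpos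
  set Nn : ℕ := (W₀.baseChange ℚ).conductorNorm ℤ with hNndef
  have hNn0 : 0 < Nn := conductorNorm_pos_holds (W₀.baseChange ℚ)
  -- `X ∣ N`: `X` is odd (`2 ∣ Y`, `gcd(X,Y) = 1`) and squarefree, and its primes are multiplicative
  have hX2 : ¬ 2 ∣ X := by
    intro h2X
    have h2Y : 2 ∣ Y := dvd_trans (by norm_num) h4
    have := Nat.dvd_gcd h2X h2Y
    rw [hcop.gcd_eq_one] at this
    omega
  have hXN : X ∣ Nn := by
    rw [← Nat.prod_primeFactors_of_squarefree hsq]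
    refine Finset.prod_primes_dvd Nn (fun p hp ↦ Nat.prime_iff.mp (Nat.prime_of_mem_primeFactors hp))
      (fun p hp ↦ ?_)
    have hpp : p.Prime := Nat.prime_of_mem_primeFactors hp
    have hpX : p ∣ X := Nat.dvd_of_mem_primeFactors hp
    have hp2 : p ≠ 2 := by rintro rfl; exact hX2 hpX
    refine hodd p (Nat.mem_primeFactors.mpr ⟨hpp, ?_, habc0⟩) hp2
    exact (dvd_pow hpX three_ne_zero).trans (by rw [hcdef]; exact dvd_mul_left _ _)
  have hXleN : X ≤ Nn := Nat.le_of_dvd hNn0 hXN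
  -- `|Δ_min| = |Δ(W₀)| ≤ (abc)² ≤ X¹⁸ ≤ N¹⁸`
  have hΔ0 : W₀.Δ ≠ 0 := by
    intro h0
    apply hE.isUnit.ne_zero
    simp [WeierstrassCurve.baseChange, WeierstrassCurve.map_Δ, h0]
  have hΔmin : (W₀.baseChange ℚ).minimalDiscriminantNorm ℤ = W₀.Δ.natAbs :=
    WeierstrassCurve.minimalDiscriminantNorm_eq_natAbs_holds W₀ hΔ0 hmin
  have hΔpos : 0 < (W₀.baseChange ℚ).minimalDiscriminantNorm ℤ :=
    WeierstrassCurve.minimalDiscriminantNorm_pos_holds _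
  have habcX : a * b * c ≤ X ^ 9 := by
    have hale : a ≤ X ^ 3 := hlt.le
    have hble : b ≤ X ^ 3 := Nat.sub_le _ _
    calc a * b * c ≤ X ^ 3 * X ^ 3 * X ^ 3 :=
          Nat.mul_le_mul (Nat.mul_le_mul hale hble) le_rfl
      _ = X ^ 9 := by ring
  have hΔN : (W₀.baseChange ℚ).minimalDiscriminantNorm ℤ ≤ Nn ^ 18 := by
    rw [hΔmin]
    calc W₀.Δ.natAbs ≤ (a * b * c) ^ 2 := hΔle
      _ ≤ (X ^ 9) ^ 2 := Nat.pow_le_pow_left habcX 2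
      _ = X ^ 18 := by ring
      _ ≤ Nn ^ 18 := Nat.pow_le_pow_left hXleN 18
  -- notation as in `WeightedSzpiroBound.abcLe_of`
  set N : ℝ := ((Nn : ℕ) : ℝ) with hNdef
  set T : ℕ := ∏ p ∈ ((W₀.baseChange ℚ).conductorNorm ℤ).primeFactors with
      ¬ p ^ 2 ∣ (W₀.baseChange ℚ).conductorNorm ℤ,
        ((W₀.baseChange ℚ).minimalDiscriminantNorm ℤ).factorization p with hTdef
  set H : ℝ := ((max |W₀.Δ| (|W₀.c₄| ^ 3) : ℤ) : ℝ) with hHdef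
  have hNpos : 0 < N := by rw [hNdef]; exact_mod_cast hNn0
  have hN1 : (1 : ℝ) ≤ N := by rw [hNdef]; exact_mod_cast hNn0
  have hNR : N ≤ 2 ^ 10 * R := by
    have h1 : Nn ≤ rad a b c := Nat.le_of_dvd hRpos hNdvd
    have h2 : (N : ℝ) ≤ R := by rw [hNdef, hRdef]; exact_mod_cast h1
    have h3 : R ≤ 2 ^ 10 * R := by nlinarith
    exact h2.trans h3
  -- THINNESS IS INERT: `T ≤ K₀ |Δ_min|^{θ/18} ≤ K₀ N^θ`
  have hthin : (T : ℝ) ≤ K₀ * N ^ θ := by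
    have h1 := hK₀abs _ hΔpos (((W₀.baseChange ℚ).conductorNorm ℤ).primeFactors.filter
      (fun p ↦ ¬ p ^ 2 ∣ (W₀.baseChange ℚ).conductorNorm ℤ))
      (fun p hp ↦ Nat.prime_of_mem_primeFactors (Finset.mem_filter.mp hp).1)
    have h2 : (((W₀.baseChange ℚ).minimalDiscriminantNorm ℤ : ℕ) : ℝ) ≤ N ^ (18 : ℕ) := by
      rw [hNdef]; exact_mod_cast hΔN
    have h3 : (((W₀.baseChange ℚ).minimalDiscriminantNorm ℤ : ℕ) : ℝ) ^ η₀ ≤ (N ^ (18 : ℕ)) ^ η₀ :=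
      Real.rpow_le_rpow (by positivity) h2 hη₀.le
    have h4' : (N ^ (18 : ℕ)) ^ η₀ = N ^ θ := by
      rw [← Real.rpow_natCast, ← Real.rpow_mul hNpos.le, hη₀def]
      congr 1
      push_cast
      ring
    rw [hTdef]
    calc _ ≤ K₀ * (((W₀.baseChange ℚ).minimalDiscriminantNorm ℤ : ℕ) : ℝ) ^ η₀ := h1
      _ ≤ K₀ * (N ^ (18 : ℕ)) ^ η₀ := mul_le_mul_of_nonneg_left h3 hK₀.le
      _ = K₀ * N ^ θ := by rw [h4']
  -- the crux on `W₀`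
  have key := hC₁ W₀ hE hmin hss' hfrey (by rw [hNdef, hNndef] at hthin; rw [hTdef] at hthin; exact hthin)
  -- `|Δ_min| ≤ H`, `H ≥ 1`
  have hΔH : (((W₀.baseChange ℚ).minimalDiscriminantNorm ℤ : ℕ) : ℝ) ≤ H := by
    rw [hΔmin, hHdef, Nat.cast_natAbs]
    exact Int.cast_le.mpr (le_max_left _ _)
  have hΔ1 : (1 : ℝ) ≤ (((W₀.baseChange ℚ).minimalDiscriminantNorm ℤ : ℕ) : ℝ) := by
    exact_mod_cast hΔpos
  have hH1 : 1 ≤ H := hΔ1.trans hΔH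
  have hH0 : 0 < H := one_pos.trans_le hH1
  -- `T ≤ K |Δ_min|^η ≤ K H^η`
  have hTH : (T : ℝ) ≤ K * H ^ η := by
    have h1 := hKabs _ hΔpos (((W₀.baseChange ℚ).conductorNorm ℤ).primeFactors.filter
      (fun p ↦ ¬ p ^ 2 ∣ (W₀.baseChange ℚ).conductorNorm ℤ))
      (fun p hp ↦ Nat.prime_of_mem_primeFactors (Finset.mem_filter.mp hp).1)
    rw [hTdef]
    exact h1.trans (mul_le_mul_of_nonneg_left (Real.rpow_le_rpow (by positivity) hΔH hη.le) hK.le)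
  have hT0 : (0 : ℝ) ≤ T := Nat.cast_nonneg T
  -- `H ≤ C (N T)^{6+x} ≤ (C K^{6+x} N^{6+x}) · H^θ'`
  have h6x : (0 : ℝ) ≤ 6 + x := by linarith
  have hH : H ≤ (C * K ^ (6 + x) * N ^ (6 + x)) * H ^ θ' := by
    have k1 : H ≤ C₁ * (N * T) ^ (6 + x) := by
      have := key
      rw [hHdef, hNdef, hNndef, hTdef]
      exact this
    have hNT0 : 0 ≤ (N * T) ^ (6 + x) := Real.rpow_nonneg (mul_nonneg hNpos.le hT0) _
    calc H ≤ C₁ * (N * T) ^ (6 + x) := k1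
      _ ≤ C * (N * T) ^ (6 + x) := mul_le_mul_of_nonneg_right (le_max_left _ _) hNT0
      _ ≤ C * (N * (K * H ^ η)) ^ (6 + x) :=
          mul_le_mul_of_nonneg_left (Real.rpow_le_rpow (mul_nonneg hNpos.le hT0)
            (mul_le_mul_of_nonneg_left hTH hNpos.le) h6x) hC0.le
      _ = (C * K ^ (6 + x) * N ^ (6 + x)) * H ^ θ' := by
          rw [Real.mul_rpow hNpos.le (by positivity), Real.mul_rpow hK.le (by positivity),
            ← Real.rpow_mul hH0.le, hθ'def]
          ring
  -- self-improvement
  have hH' : H ≤ K₁ * N ^ e := by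
    have h := TwoAdicEisensteinAnchor.SlackTransfer.le_rpow_of_le_mul_rpow hH0 hθ'1 hH
    rw [Real.mul_rpow (by positivity) (Real.rpow_nonneg hNpos.le _), ← Real.rpow_mul hNpos.le] at h
    rw [hK₁def, hedef, div_eq_mul_one_div (6 + x) (1 - θ')]
    exact h
  -- `c⁶ ≤ 8 |c₄|³ ≤ 8 H ≤ 8 K₁ (2¹⁰ R)^e = M R^e`
  have hc2 : (c : ℝ) ^ 2 ≤ 2 * |(W₀.c₄ : ℝ)| := by exact_mod_cast hc₄
  have hc₄H : |(W₀.c₄ : ℝ)| ^ 3 ≤ H := by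
    have hz : |W₀.c₄| ^ 3 ≤ max |W₀.Δ| (|W₀.c₄| ^ 3) := le_max_right _ _
    have hr : ((|W₀.c₄| ^ 3 : ℤ) : ℝ) ≤ H := by rw [hHdef]; exact_mod_cast hz
    simpa [Int.cast_pow, Int.cast_abs] using hr
  have h6 : (c : ℝ) ^ 6 ≤ M * R ^ e := by
    have h := TwoAdicEisensteinAnchor.SlackTransfer.pow_six_le hK₁ hNpos he0 hc2 hc₄H hH' hNR
    calc (c : ℝ) ^ 6 ≤ 8 * K₁ * (2 ^ 10 * R) ^ e := h
      _ = M * R ^ e := by rw [hMdef, Real.mul_rpow (by positivity) (by positivity)]; ring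
  have hfinal : (c : ℝ) ≤ M ^ (1 / 6 : ℝ) * R ^ (1 + ε) := le_of_pow_six_le (Nat.cast_nonneg c) hM hR he6 h6
  have hcX : (c : ℝ) = (X : ℝ) ^ 3 := by rw [hcdef]; push_cast; ring
  rw [hcX] at hfinal
  rw [hRdef, hadef, hbdef, hcdef] at hfinal
  exact hfinal

/-! ## … hence Hall's conjecture on the class -/

/-- Real bookkeeping of `Literature…AbcImpliesHall.hall_of_abc_exponent` (Steps 1–5), isolated from its
abc hypothesis: from `x³ < C (x · y · |x³ − y²|)^{1+ε}` for ONE pair `(x, y)` and `(3 − δ)(1 + ε) ≤ 3`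
one gets the Hall bound `min 1 (1/(C 2^{1+ε})) · x^{1/2−δ} ≤ |x³ − y²|` for that pair.
[cite: BombieriGubler2006, Thm. 12.5.12 (proof of (a) ⇒ (b))] -/
theorem hall_of_cube_lt {ε δ C : ℝ} (hε : 0 ≤ ε) (hδ : 0 < δ) (hC : 0 < C)
    (hδε : (3 - δ) * (1 + ε) ≤ 3) {x y : ℕ} (hx : 0 < x)
    (key : (x : ℝ) ^ 3 < C * ((x : ℝ) * y * |(x : ℝ) ^ 3 - (y : ℝ) ^ 2|) ^ (1 + ε)) :
    min 1 (1 / (C * 2 ^ (1 + ε))) * (x : ℝ) ^ (1 / 2 - δ : ℝ) ≤ |(x : ℝ) ^ 3 - (y : ℝ) ^ 2| := by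
  have hy2 : (y : ℝ) ^ 2 ≤ (x : ℝ) ^ 3 + |(x : ℝ) ^ 3 - (y : ℝ) ^ 2| := by
    have h := neg_abs_le ((x : ℝ) ^ 3 - (y : ℝ) ^ 2)
    linarith
  have ht0 : 0 ≤ |(x : ℝ) ^ 3 - (y : ℝ) ^ 2| := abs_nonneg _
  generalize |(x : ℝ) ^ 3 - (y : ℝ) ^ 2| = t at key hy2 ht0 ⊢
  set K : ℝ := C * 2 ^ (1 + ε) with hK
  have hK0 : 0 < K := by rw [hK]; positivity
  have hX1 : (1 : ℝ) ≤ x := by exact_mod_cast hx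
  have hX0 : (0 : ℝ) < x := by positivity
  have h1e : 0 < 1 + ε := by linarith
  have hmin0 : 0 < min 1 (1 / K) := lt_min one_pos (by positivity)
  have hmin1 : min 1 (1 / K) ≤ 1 := min_le_left _ _
  have hminK : min 1 (1 / K) ≤ 1 / K := min_le_right _ _
  have hXpow0 : 0 ≤ (x : ℝ) ^ (1 / 2 - δ : ℝ) := Real.rpow_nonneg hX0.le _
  by_contra hlt
  push Not at hlt
  -- Step 1: `t < x`
  have htX : t < x :=
    calc t < min 1 (1 / K) * (x : ℝ) ^ (1 / 2 - δ : ℝ) := hlt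
      _ ≤ 1 * (x : ℝ) ^ (1 / 2 - δ : ℝ) := mul_le_mul_of_nonneg_right hmin1 hXpow0
      _ ≤ (x : ℝ) ^ (1 : ℝ) := by
          rw [one_mul]
          exact Real.rpow_le_rpow_of_exponent_le hX1 (by linarith)
      _ = x := Real.rpow_one _
  -- Step 2: `y < 2 x^{3/2}`
  have h32 : ((x : ℝ) ^ (3 / 2 : ℝ)) ^ 2 = (x : ℝ) ^ 3 := by
    rw [← Real.rpow_two, ← Real.rpow_mul hX0.le,
      show (3 / 2 : ℝ) * 2 = ((3 : ℕ) : ℝ) by norm_num, Real.rpow_natCast]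
  have hY : (y : ℝ) < 2 * (x : ℝ) ^ (3 / 2 : ℝ) := by
    have hx3 : (x : ℝ) ≤ (x : ℝ) ^ 3 := by
      calc (x : ℝ) = (x : ℝ) ^ 1 := (pow_one _).symm
        _ ≤ (x : ℝ) ^ 3 := pow_le_pow_right₀ hX1 (by norm_num)
    have hy2' : (y : ℝ) ^ 2 < (2 * (x : ℝ) ^ (3 / 2 : ℝ)) ^ 2 := by
      rw [mul_pow, h32]
      nlinarith [pow_pos hX0 3]
    exact lt_of_pow_lt_pow_left₀ 2 (by positivity) hy2'
  -- Step 3: `(x y t)^{1+ε} ≤ 2^{1+ε} x^{(5/2)(1+ε)} t^{1+ε}`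
  have hstep3 : ((x : ℝ) * y * t) ^ (1 + ε)
      ≤ (2 : ℝ) ^ (1 + ε) * (x : ℝ) ^ ((5 / 2) * (1 + ε)) * t ^ (1 + ε) := by
    have h52 : (x : ℝ) * (2 * (x : ℝ) ^ (3 / 2 : ℝ)) = 2 * (x : ℝ) ^ (5 / 2 : ℝ) := by
      rw [show (5 / 2 : ℝ) = 1 + 3 / 2 by norm_num, Real.rpow_add hX0, Real.rpow_one]
      ring
    have hx52 : (0 : ℝ) ≤ 2 * (x : ℝ) ^ (5 / 2 : ℝ) :=
      mul_nonneg zero_le_two (Real.rpow_nonneg hX0.le _)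
    have hle : (x : ℝ) * y * t ≤ 2 * (x : ℝ) ^ (5 / 2 : ℝ) * t := by
      rw [← h52]
      exact mul_le_mul_of_nonneg_right (mul_le_mul_of_nonneg_left hY.le hX0.le) ht0
    have hxyt : (0 : ℝ) ≤ (x : ℝ) * y * t :=
      mul_nonneg (mul_nonneg hX0.le (Nat.cast_nonneg y)) ht0
    calc ((x : ℝ) * y * t) ^ (1 + ε) ≤ (2 * (x : ℝ) ^ (5 / 2 : ℝ) * t) ^ (1 + ε) :=
          Real.rpow_le_rpow hxyt hle h1e.le
      _ = (2 : ℝ) ^ (1 + ε) * (x : ℝ) ^ ((5 / 2) * (1 + ε)) * t ^ (1 + ε) := by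
          rw [Real.mul_rpow hx52 ht0, Real.mul_rpow zero_le_two (Real.rpow_nonneg hX0.le _),
            ← Real.rpow_mul hX0.le]
  -- Step 4: `t^{1+ε} < (1/K) x^{(1/2 − δ)(1+ε)}`
  have hstep4 : t ^ (1 + ε) < 1 / K * (x : ℝ) ^ ((1 / 2 - δ) * (1 + ε)) := by
    have h1 : t ^ (1 + ε) < (min 1 (1 / K) * (x : ℝ) ^ (1 / 2 - δ : ℝ)) ^ (1 + ε) :=
      Real.rpow_lt_rpow ht0 hlt h1e
    rw [Real.mul_rpow hmin0.le hXpow0, ← Real.rpow_mul hX0.le] at h1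
    have h3 : (min 1 (1 / K)) ^ (1 + ε) ≤ 1 / K :=
      (Real.rpow_le_self_of_le_one hmin0.le hmin1 (by linarith)).trans hminK
    exact h1.trans_le (mul_le_mul_of_nonneg_right h3 (Real.rpow_nonneg hX0.le _))
  -- Step 5: combine into `x³ < x³`
  have hexp : (5 / 2) * (1 + ε) + (1 / 2 - δ) * (1 + ε) ≤ ((3 : ℕ) : ℝ) := by
    have h : (5 / 2) * (1 + ε) + (1 / 2 - δ) * (1 + ε) = (3 - δ) * (1 + ε) := by ring
    rw [h]
    exact_mod_cast hδε
  have hlt3 : (x : ℝ) ^ 3 < (x : ℝ) ^ 3 :=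
    calc (x : ℝ) ^ 3 < C * ((x : ℝ) * y * t) ^ (1 + ε) := key
      _ ≤ C * ((2 : ℝ) ^ (1 + ε) * (x : ℝ) ^ ((5 / 2) * (1 + ε)) * t ^ (1 + ε)) :=
          mul_le_mul_of_nonneg_left hstep3 hC.le
      _ = K * (x : ℝ) ^ ((5 / 2) * (1 + ε)) * t ^ (1 + ε) := by
          rw [hK]
          ring
      _ < K * (x : ℝ) ^ ((5 / 2) * (1 + ε)) * (1 / K * (x : ℝ) ^ ((1 / 2 - δ) * (1 + ε))) :=
          mul_lt_mul_of_pos_left hstep4 (mul_pos hK0 (Real.rpow_pos_of_pos hX0 _))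
      _ = (x : ℝ) ^ ((5 / 2) * (1 + ε) + (1 / 2 - δ) * (1 + ε)) := by
          rw [Real.rpow_add hX0,
            show K * (x : ℝ) ^ ((5 / 2) * (1 + ε)) * (1 / K * (x : ℝ) ^ ((1 / 2 - δ) * (1 + ε)))
              = K * (1 / K) * ((x : ℝ) ^ ((5 / 2) * (1 + ε)) * (x : ℝ) ^ ((1 / 2 - δ) * (1 + ε)))
              by ring,
            mul_one_div_cancel hK0.ne', one_mul]
      _ ≤ (x : ℝ) ^ ((3 : ℕ) : ℝ) := Real.rpow_le_rpow_of_exponent_le hX1 hexp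
      _ = (x : ℝ) ^ 3 := Real.rpow_natCast _ 3
  exact lt_irrefl _ hlt3

/-- **The Frey re-cut of r3″ implies Hall's conjecture on the class
`{x squarefree, 4 ∣ y, gcd(x, y) = 1, y² < x³}`** — the body of
`Literature.NumberTheory.DiophantineGeometry.HallConjecture` (abc.S17, OPEN: "very little is known",
Silverman AEC IX.7) restricted to an infinite Hall-generic two-parameter family.  So re-cutting r3″ to the
Frey–Hellegouarch class does not remove its Hall kernel.
[cite: BombieriGubler2006, 12.5.1 and Thm. 12.5.12] [cite: SilvermanAEC2009, §IX.7 Conj. 7.4] -/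
theorem hallOnClass_of_thinFrey (hT : ThinWeightedSzpiroFrey) :
    ∀ δ : ℝ, 0 < δ → ∃ C : ℝ, 0 < C ∧ ∀ X Y : ℕ, 0 < X → 0 < Y → Y ^ 2 < X ^ 3 → 4 ∣ Y →
      Nat.Coprime X Y → Squarefree X →
      C * (X : ℝ) ^ (1 / 2 - δ : ℝ) ≤ |(X : ℝ) ^ 3 - (Y : ℝ) ^ 2| := by
  intro δ hδ
  obtain ⟨C', hC'⟩ := hallTripleAbc_of_thinFrey hT (δ / 3) (by positivity)
  set C₀ : ℝ := max C' 0 + 1 with hC₀def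
  have hC₀ : 0 < C₀ := by rw [hC₀def]; positivity
  have hε : (0 : ℝ) ≤ δ / 3 := by positivity
  refine ⟨min 1 (1 / (C₀ * 2 ^ (1 + δ / 3))), lt_min one_pos (by positivity),
    fun X Y hX hY hlt h4 hcop hsq ↦ ?_⟩
  have habc := hC' X Y hX hY hlt h4 hcop hsq
  -- `rad(Y² (X³−Y²) X³) ≤ X · Y · (X³ − Y²)`
  have hb0 : X ^ 3 - Y ^ 2 ≠ 0 := (Nat.sub_pos_of_lt hlt).ne'
  have hr : rad (Y ^ 2) (X ^ 3 - Y ^ 2) (X ^ 3) ≤ X * Y * (X ^ 3 - Y ^ 2) := by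
    rw [rad_def]
    calc radical (Y ^ 2 * (X ^ 3 - Y ^ 2) * X ^ 3)
          ≤ radical (Y ^ 2) * radical (X ^ 3 - Y ^ 2) * radical (X ^ 3) := radical_mul_three_le _ _ _
      _ ≤ Y * (X ^ 3 - Y ^ 2) * X :=
          Nat.mul_le_mul (Nat.mul_le_mul (radical_le_of_dvd_pow hY.ne' dvd_rfl)
            (Nat.radical_le_self_iff.mpr hb0)) (radical_le_of_dvd_pow hX.ne' dvd_rfl)
      _ = X * Y * (X ^ 3 - Y ^ 2) := by ring
  have hD : ((X ^ 3 - Y ^ 2 : ℕ) : ℝ) = |(X : ℝ) ^ 3 - (Y : ℝ) ^ 2| := by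
    have hle : ((Y ^ 2 : ℕ) : ℝ) ≤ ((X ^ 3 : ℕ) : ℝ) := by exact_mod_cast hlt.le
    rw [Nat.cast_sub hlt.le, abs_of_nonneg (by push_cast at hle ⊢; linarith)]
    push_cast; ring
  have hxyt0 : (0 : ℝ) ≤ (X : ℝ) * Y * |(X : ℝ) ^ 3 - (Y : ℝ) ^ 2| := by positivity
  have h1e : (0 : ℝ) < 1 + δ / 3 := by linarith
  have hRle : ((rad (Y ^ 2) (X ^ 3 - Y ^ 2) (X ^ 3) : ℕ) : ℝ) ^ (1 + δ / 3)
      ≤ ((X : ℝ) * Y * |(X : ℝ) ^ 3 - (Y : ℝ) ^ 2|) ^ (1 + δ / 3) := by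
    refine Real.rpow_le_rpow (Nat.cast_nonneg _) ?_ h1e.le
    rw [← hD]; exact_mod_cast hr
  have hpos : 0 < ((X : ℝ) * Y * |(X : ℝ) ^ 3 - (Y : ℝ) ^ 2|) ^ (1 + δ / 3) := by
    apply Real.rpow_pos_of_pos
    have hk : (0 : ℝ) < |(X : ℝ) ^ 3 - (Y : ℝ) ^ 2| := by
      rw [← hD]; exact_mod_cast Nat.sub_pos_of_lt hlt
    positivity
  have key : (X : ℝ) ^ 3 < C₀ * ((X : ℝ) * Y * |(X : ℝ) ^ 3 - (Y : ℝ) ^ 2|) ^ (1 + δ / 3) :=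
    calc (X : ℝ) ^ 3 ≤ C' * ((rad (Y ^ 2) (X ^ 3 - Y ^ 2) (X ^ 3) : ℕ) : ℝ) ^ (1 + δ / 3) := habc
      _ ≤ max C' 0 * ((rad (Y ^ 2) (X ^ 3 - Y ^ 2) (X ^ 3) : ℕ) : ℝ) ^ (1 + δ / 3) :=
          mul_le_mul_of_nonneg_right (le_max_left _ _) (Real.rpow_nonneg (Nat.cast_nonneg _) _)
      _ ≤ max C' 0 * ((X : ℝ) * Y * |(X : ℝ) ^ 3 - (Y : ℝ) ^ 2|) ^ (1 + δ / 3) :=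
          mul_le_mul_of_nonneg_left hRle (le_max_right _ _)
      _ < C₀ * ((X : ℝ) * Y * |(X : ℝ) ^ 3 - (Y : ℝ) ^ 2|) ^ (1 + δ / 3) := by
          rw [hC₀def]; nlinarith
  exact hall_of_cube_lt hε hδ hC₀ (by nlinarith [sq_nonneg δ]) hX key

end Summit.ABC.ABC.Cruxes.ThinWeightedSzpiro.FreyHallKernel

end
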